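import Mathlib

/-!
# T⁴ programme, spine node NE2 (U1a), sub-row Δ1 «NE2⁰-Dirichlet» — CUTOFF CALCULUS: a clamped `C^{1,1}` step, its discrete Taylor
# remainder, and the first/second DIFFERENCE bounds for compositions and (finite) products of cutoffs (route r5, file F-W2a)

NE2 formalisation swarm `b2b-balaban-t4-ne2-formalise-*`, LEAF PROVER 09 (gen 10), first brick of the geometric file F-W2 of route r5 (memo
`t4/T4-EST-NE2-D1-CORNER.md` §4; journal `HOME/CLAIMS.log` 2026-08-21 l.25057).  The corner-cutoff `H²` bounds
(`DirichletCornerCutoffH2Local.weighted_hdiag_le_local`, p244390; family form `DirichletWeightedHessian`, p245063) take, for each cutoff `φ`,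
POINTWISE bounds `|φ(y±e_ν) − φ(y)| ≤ g(y)` and `|φ(y+e_ν) + φ(y−e_ν) − 2φ(y)| ≤ h(y)`.  The dyadic cutoffs of F-W2 are PRODUCTS over the
re-entrant faces of a box hole of `θ(dist²(·, face)/R²)` with a clamped cubic step `θ`; THIS FILE is the lattice-free calculus that turns
bounds on the inner function (squared distances: first differences `≲ R`, second differences `≤ 2`, in units of `R²`) into the `g`, `h` of
such products — pure real algebra, stated on VALUES (`q0 = Q(y)`, `qp = Q(y+e)`, `qm = Q(y−e)`), so that any lattice and any shift apply:
 * `cstep` (`= 0` on `u ≤ 0`, `= 3u² − 2u³` on `[0,1]`, `= 1` on `u ≥ 1`) and its derivative `cstepD` (`6u(1−u)` inside, `0` outside);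
   `cstep_mem`, `abs_cstepD_le` (`≤ 3/2`), **`cstep_taylor`** (`|θ(v) − θ(u) − θ′(u)(v−u)| ≤ 3(v−u)²`, all real `u v` — the `C^{1,1}`
   remainder across the clamping knots), **`cstep_lip`** (`|θ(v) − θ(u)| ≤ (3/2)|v−u|`);
 * **`cstep_comp_second_diff`**: `|θ(qp) + θ(qm) − 2θ(q0)| ≤ (3/2)|qp + qm − 2q0| + 3((qp−q0)² + (qm−q0)²)`;
 * **`abs_mul_diff_le`**, **`abs_mul_second_diff_le`**: first/second differences of a product of two `[−1,1]`-valued cutoffs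
   (`g_φ + g_ψ`, `h_φ + h_ψ + 2g_φg_ψ`);
 * **`abs_prod_diff_le`**, **`abs_prod_second_diff_le`**: the same for a finite product (`Σ_j g_j`, `Σ_j h_j + (Σ_j g_j)²`).

HONEST FRAMING (T4-DAG p. 1).  [folklore] elementary real inequalities; no lattice, no region, no estimate of any Bałaban object; nothing about
[B9]'s printed regions; `hinjK` ∕ W3 off boxes OPEN; Δ1 NOT closed; NE2 (U1a) NOT proved; spine PROVED 0/9 unchanged; NOT infinite volume, NOT
a mass gap, NOT the Clay problem.  HONEST DEPENDENCY: continuum YM on T⁴ ⇐ BetaPertH ∧ nine spine estimates (0/9 proved); BetaPertH ⇐ (D1) ∧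
(D4) ∧ CAP+tail; G-an2-4 gates asym, D1 and NE2/3/4.  No `sorry`.
-/

noncomputable section

open scoped BigOperators
open Finset

namespace Summit.QuantumFields.BalabanUV.T4Continuum.DirichletCutoffCalculus

/-! ## §1 The clamped cubic step and its `C^{1,1}` Taylor remainder -/

/-- **THE CLAMPED CUBIC STEP** `θ`: `0` for `u ≤ 0`, `3u² − 2u³` for `0 ≤ u ≤ 1`, `1` for `u ≥ 1` (`C¹` with Lipschitz derivative).
[folklore] -/
def cstep (u : ℝ) : ℝ := if u ≤ 0 then 0 else if 1 ≤ u then 1 else 3 * u ^ 2 - 2 * u ^ 3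

/-- its derivative `θ′`: `6u(1−u)` inside `[0,1]`, `0` outside. [folklore] -/
def cstepD (u : ℝ) : ℝ := if u ≤ 0 then 0 else if 1 ≤ u then 0 else 6 * u * (1 - u)

/-- `θ(u) = 0` for `u ≤ 0`. [folklore] -/
theorem cstep_of_nonpos {u : ℝ} (h : u ≤ 0) : cstep u = 0 := by unfold cstep; rw [if_pos h]

/-- `θ(u) = 1` for `u ≥ 1`. [folklore] -/
theorem cstep_of_one_le {u : ℝ} (h : 1 ≤ u) : cstep u = 1 := by
  unfold cstep; rw [if_neg (by linarith), if_pos h]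

/-- `θ(u) = 3u² − 2u³` for `0 < u < 1`. [folklore] -/
theorem cstep_of_mem {u : ℝ} (h0 : 0 < u) (h1 : u < 1) : cstep u = 3 * u ^ 2 - 2 * u ^ 3 := by
  unfold cstep; rw [if_neg (not_le.2 h0), if_neg (not_le.2 h1)]

/-- `θ′(u) = 0` for `u ≤ 0`. [folklore] -/
theorem cstepD_of_nonpos {u : ℝ} (h : u ≤ 0) : cstepD u = 0 := by unfold cstepD; rw [if_pos h]

/-- `θ′(u) = 0` for `u ≥ 1`. [folklore] -/
theorem cstepD_of_one_le {u : ℝ} (h : 1 ≤ u) : cstepD u = 0 := by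
  unfold cstepD; rw [if_neg (by linarith), if_pos h]

/-- `θ′(u) = 6u(1−u)` for `0 < u < 1`. [folklore] -/
theorem cstepD_of_mem {u : ℝ} (h0 : 0 < u) (h1 : u < 1) : cstepD u = 6 * u * (1 - u) := by
  unfold cstepD; rw [if_neg (not_le.2 h0), if_neg (not_le.2 h1)]

/-- `0 ≤ θ ≤ 1`. [folklore] -/
theorem cstep_mem (u : ℝ) : 0 ≤ cstep u ∧ cstep u ≤ 1 := by
  by_cases h0 : u ≤ 0
  · rw [cstep_of_nonpos h0]; exact ⟨le_rfl, zero_le_one⟩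
  by_cases h1 : 1 ≤ u
  · rw [cstep_of_one_le h1]; exact ⟨zero_le_one, le_rfl⟩
  push Not at h0 h1
  rw [cstep_of_mem h0 h1]
  exact ⟨by nlinarith [mul_nonneg (sq_nonneg u) (by linarith : (0 : ℝ) ≤ 3 - 2 * u)],
    by nlinarith [mul_nonneg (sq_nonneg (1 - u)) (by linarith : (0 : ℝ) ≤ 1 + 2 * u)]⟩

/-- `|θ| ≤ 1`. [folklore] -/
theorem abs_cstep_le (u : ℝ) : |cstep u| ≤ 1 :=
  abs_le.2 ⟨by linarith [(cstep_mem u).1], (cstep_mem u).2⟩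

/-- `|θ′| ≤ 3/2`. [folklore] -/
theorem abs_cstepD_le (u : ℝ) : |cstepD u| ≤ 3 / 2 := by
  by_cases h0 : u ≤ 0
  · rw [cstepD_of_nonpos h0]; norm_num
  by_cases h1 : 1 ≤ u
  · rw [cstepD_of_one_le h1]; norm_num
  push Not at h0 h1
  rw [cstepD_of_mem h0 h1, abs_of_nonneg (by nlinarith)]
  nlinarith [sq_nonneg (u - 1 / 2)]

/-- the cubic identity behind the Taylor remainder: `S(v) − S(u) − S′(u)(v−u) = (v−u)²(3 − 2v − 4u)`. [folklore] -/
theorem cubic_taylor_identity (u v : ℝ) :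
    (3 * v ^ 2 - 2 * v ^ 3) - (3 * u ^ 2 - 2 * u ^ 3) - 6 * u * (1 - u) * (v - u) = (v - u) ^ 2 * (3 - 2 * v - 4 * u) := by ring

/-- **THE `C^{1,1}` TAYLOR REMAINDER OF THE CLAMPED STEP**: `|θ(v) − θ(u) − θ′(u)(v − u)| ≤ 3(v − u)²` for ALL real `u`, `v` (inside
`[0,1]²` the cubic identity gives the factor `|3 − 2v − 4u| ≤ 3`; across the knots the clamped pieces are matched by `S(t) ≤ 3t²`,
`1 − S(t) = (1−t)²(1+2t) ≤ 3(1−t)²` and `S′(t) = 6t(1−t)`). [folklore] -/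
theorem cstep_taylor (u v : ℝ) : |cstep v - cstep u - cstepD u * (v - u)| ≤ 3 * (v - u) ^ 2 := by
  have hsq : 0 ≤ (v - u) ^ 2 := sq_nonneg _
  by_cases hu0 : u ≤ 0
  · rw [cstep_of_nonpos hu0, cstepD_of_nonpos hu0, zero_mul, sub_zero, sub_zero]
    by_cases hv0 : v ≤ 0
    · rw [cstep_of_nonpos hv0, abs_zero]; positivity
    by_cases hv1 : 1 ≤ v
    · rw [cstep_of_one_le hv1, abs_one]; nlinarith
    push Not at hv0 hv1
    rw [cstep_of_mem hv0 hv1, abs_of_nonneg (by nlinarith [mul_nonneg (sq_nonneg v) (by linarith : (0 : ℝ) ≤ 3 - 2 * v)])]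
    nlinarith [mul_nonneg (sq_nonneg v) hv0.le, mul_nonneg (neg_nonneg.2 hu0) hv0.le, mul_nonneg (mul_nonneg (neg_nonneg.2 hu0) hv0.le) hv0.le]
  by_cases hu1 : 1 ≤ u
  · rw [cstep_of_one_le hu1, cstepD_of_one_le hu1, zero_mul, sub_zero]
    by_cases hv0 : v ≤ 0
    · rw [cstep_of_nonpos hv0]; norm_num; nlinarith
    by_cases hv1 : 1 ≤ v
    · rw [cstep_of_one_le hv1, sub_self, abs_zero]; positivity
    push Not at hv0 hv1
    have e1 : (3 * v ^ 2 - 2 * v ^ 3) - 1 = -((1 - v) ^ 2 * (1 + 2 * v)) := by ring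
    rw [cstep_of_mem hv0 hv1, e1, abs_neg, abs_of_nonneg (by nlinarith [mul_nonneg (sq_nonneg (1 - v)) hv0.le])]
    nlinarith [mul_nonneg (sq_nonneg (1 - v)) hv0.le, mul_nonneg (sq_nonneg (1 - v)) (sub_pos.2 hv1).le,
      mul_nonneg (mul_nonneg (sub_nonneg.2 hu1) (sub_pos.2 hv1).le) (by linarith : (0 : ℝ) ≤ 1 + 2 * v),
      mul_nonneg (sub_nonneg.2 hu1) (sub_pos.2 hv1).le]
  push Not at hu0 hu1
  rw [cstep_of_mem hu0 hu1, cstepD_of_mem hu0 hu1]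
  have hD : 0 ≤ 6 * u * (1 - u) := by nlinarith
  by_cases hv0 : v ≤ 0
  · -- compare with the Taylor polynomial at `0`
    rw [cstep_of_nonpos hv0]
    have e : (0 : ℝ) - (3 * u ^ 2 - 2 * u ^ 3) - 6 * u * (1 - u) * (v - u) = u ^ 2 * (3 - 4 * u) + 6 * u * (1 - u) * (-v) := by ring
    rw [e]
    refine (abs_add_le _ _).trans ?_
    rw [abs_mul, abs_of_nonneg (sq_nonneg u), abs_mul, abs_of_nonneg hD, abs_of_nonneg (neg_nonneg.2 hv0)]
    have hA : |3 - 4 * u| ≤ 3 := abs_le.2 ⟨by linarith, by linarith⟩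
    nlinarith [mul_le_mul_of_nonneg_left hA (sq_nonneg u), mul_nonneg hu0.le (neg_nonneg.2 hv0),
      mul_nonneg (mul_nonneg hu0.le hu0.le) (neg_nonneg.2 hv0), mul_nonneg (sq_nonneg v) zero_le_three]
  by_cases hv1 : 1 ≤ v
  · -- compare with the Taylor polynomial at `1`
    rw [cstep_of_one_le hv1]
    have e : (1 : ℝ) - (3 * u ^ 2 - 2 * u ^ 3) - 6 * u * (1 - u) * (v - u)
        = (1 - u) ^ 2 * (1 - 4 * u) + -(6 * u * (1 - u) * (v - 1)) := by ring
    rw [e]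
    refine (abs_add_le _ _).trans ?_
    rw [abs_mul, abs_of_nonneg (sq_nonneg _), abs_neg, abs_mul, abs_of_nonneg hD, abs_of_nonneg (by linarith : (0 : ℝ) ≤ v - 1)]
    have hA : |1 - 4 * u| ≤ 3 := abs_le.2 ⟨by linarith, by linarith⟩
    nlinarith [mul_le_mul_of_nonneg_left hA (sq_nonneg (1 - u)), mul_nonneg (sub_pos.2 hu1).le (by linarith : (0 : ℝ) ≤ v - 1),
      mul_nonneg (mul_nonneg (sub_pos.2 hu1).le (sub_pos.2 hu1).le) (by linarith : (0 : ℝ) ≤ v - 1),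
      mul_nonneg (sq_nonneg (v - 1)) zero_le_three]
  -- both inside
  push Not at hv0 hv1
  rw [cstep_of_mem hv0 hv1, cubic_taylor_identity, abs_mul, abs_of_nonneg hsq, mul_comm]
  exact mul_le_mul_of_nonneg_right (abs_le.2 ⟨by linarith, by linarith⟩) hsq

/-- **THE CLAMPED STEP IS MONOTONE AND `3/2`-LIPSCHITZ** (one-sided form). [folklore] -/
theorem cstep_mono_lip {a b : ℝ} (hab : a ≤ b) : cstep a ≤ cstep b ∧ cstep b - cstep a ≤ 3 / 2 * (b - a) := by
  by_cases ha0 : a ≤ 0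
  · rw [cstep_of_nonpos ha0]
    by_cases hb0 : b ≤ 0
    · rw [cstep_of_nonpos hb0]; constructor <;> linarith
    by_cases hb1 : 1 ≤ b
    · rw [cstep_of_one_le hb1]; constructor <;> linarith
    push Not at hb0 hb1
    rw [cstep_of_mem hb0 hb1]
    constructor
    · nlinarith [mul_nonneg (sq_nonneg b) (by linarith : (0 : ℝ) ≤ 3 - 2 * b)]
    · nlinarith [mul_nonneg hb0.le (sq_nonneg (b - 3 / 4)), mul_nonneg (neg_nonneg.2 ha0) hb0.le]
  by_cases ha1 : 1 ≤ a
  · rw [cstep_of_one_le ha1, cstep_of_one_le (ha1.trans hab)]; constructor <;> linarith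
  push Not at ha0 ha1
  rw [cstep_of_mem ha0 ha1]
  have hb0 : 0 < b := ha0.trans_le hab
  by_cases hb1 : 1 ≤ b
  · rw [cstep_of_one_le hb1]
    have e1 : 1 - (3 * a ^ 2 - 2 * a ^ 3) = (1 - a) ^ 2 * (1 + 2 * a) := by ring
    constructor
    · nlinarith [mul_nonneg (sq_nonneg (1 - a)) (by linarith : (0 : ℝ) ≤ 1 + 2 * a)]
    · nlinarith [mul_nonneg (sub_pos.2 ha1).le (sq_nonneg (a - 1 / 4)), mul_nonneg (sub_nonneg.2 hb1) (sub_pos.2 ha1).le]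
  push Not at hb1
  rw [cstep_of_mem hb0 hb1]
  have hf : (3 * b ^ 2 - 2 * b ^ 3) - (3 * a ^ 2 - 2 * a ^ 3) = (b - a) * (3 * (a + b) - 2 * (a ^ 2 + a * b + b ^ 2)) := by ring
  have hB0 : 0 ≤ 3 * (a + b) - 2 * (a ^ 2 + a * b + b ^ 2) := by
    nlinarith [mul_nonneg ha0.le (sub_pos.2 ha1).le, mul_nonneg hb0.le (sub_pos.2 hb1).le, mul_nonneg ha0.le (sub_pos.2 hb1).le]
  have hB1 : 3 * (a + b) - 2 * (a ^ 2 + a * b + b ^ 2) ≤ 3 / 2 := by nlinarith [sq_nonneg (a - b), sq_nonneg (a + b - 1)]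
  constructor
  · nlinarith [mul_nonneg (sub_nonneg.2 hab) hB0]
  · nlinarith [mul_le_mul_of_nonneg_left hB1 (sub_nonneg.2 hab)]

/-- **THE CLAMPED STEP IS `3/2`-LIPSCHITZ**. [folklore] -/
theorem cstep_lip (u v : ℝ) : |cstep v - cstep u| ≤ 3 / 2 * |v - u| := by
  rcases le_total u v with h | h
  · obtain ⟨h1, h2⟩ := cstep_mono_lip h
    rw [abs_of_nonneg (sub_nonneg.2 h1), abs_of_nonneg (sub_nonneg.2 h)]; exact h2
  · obtain ⟨h1, h2⟩ := cstep_mono_lip h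
    rw [abs_sub_comm, abs_of_nonneg (sub_nonneg.2 h1), abs_sub_comm, abs_of_nonneg (sub_nonneg.2 h)]; exact h2

/-! ## §2 Composition with an inner function: differences of `θ ∘ Q` from those of `Q` -/

/-- **SECOND DIFFERENCES OF `θ ∘ Q`**: `|θ(qp) + θ(qm) − 2θ(q0)| ≤ (3/2)|qp + qm − 2q0| + 3((qp − q0)² + (qm − q0)²)`. [folklore] -/
theorem cstep_comp_second_diff (q0 qp qm : ℝ) :
    |cstep qp + cstep qm - 2 * cstep q0| ≤ 3 / 2 * |qp + qm - 2 * q0| + 3 * ((qp - q0) ^ 2 + (qm - q0) ^ 2) := by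
  have hp := cstep_taylor q0 qp
  have hm := cstep_taylor q0 qm
  have e : cstep qp + cstep qm - 2 * cstep q0
      = cstepD q0 * (qp + qm - 2 * q0)
        + ((cstep qp - cstep q0 - cstepD q0 * (qp - q0)) + (cstep qm - cstep q0 - cstepD q0 * (qm - q0))) := by ring
  rw [e]
  refine (abs_add_le _ _).trans (add_le_add ?_ ((abs_add_le _ _).trans (by linarith)))
  rw [abs_mul]
  exact mul_le_mul_of_nonneg_right (abs_cstepD_le q0) (abs_nonneg _)

/-! ## §3 Products of two cutoffs -/

/-- the product rule for second differences (values `φ0 = φ(y)`, `φp = φ(y+e)`, `φm = φ(y−e)`). [folklore] -/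
theorem mul_second_diff_eq (φ0 φp φm ψ0 ψp ψm : ℝ) :
    φp * ψp + φm * ψm - 2 * (φ0 * ψ0)
      = φ0 * (ψp + ψm - 2 * ψ0) + ψ0 * (φp + φm - 2 * φ0) + (φp - φ0) * (ψp - ψ0) + (φm - φ0) * (ψm - ψ0) := by ring

/-- **FIRST DIFFERENCES OF A PRODUCT** of `[−1,1]`-valued cutoffs: `|φp·ψp − φ0·ψ0| ≤ g_φ + g_ψ`. [folklore] -/
theorem abs_mul_diff_le {φ0 φp ψ0 ψp gφ gψ : ℝ} (hφ : |φ0| ≤ 1) (hψ : |ψp| ≤ 1) (hdφ : |φp - φ0| ≤ gφ) (hdψ : |ψp - ψ0| ≤ gψ) :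
    |φp * ψp - φ0 * ψ0| ≤ gφ + gψ := by
  have e : φp * ψp - φ0 * ψ0 = (φp - φ0) * ψp + φ0 * (ψp - ψ0) := by ring
  rw [e]
  refine (abs_add_le _ _).trans (add_le_add ?_ ?_)
  · rw [abs_mul]
    exact (mul_le_mul hdφ hψ (abs_nonneg _) ((abs_nonneg _).trans hdφ)).trans (le_of_eq (mul_one _))
  · rw [abs_mul]
    exact (mul_le_mul hφ hdψ (abs_nonneg _) zero_le_one).trans (le_of_eq (one_mul _))

/-- **SECOND DIFFERENCES OF A PRODUCT** of `[−1,1]`-valued cutoffs: `|φp·ψp + φm·ψm − 2φ0·ψ0| ≤ h_φ + h_ψ + 2g_φg_ψ`. [folklore] -/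
theorem abs_mul_second_diff_le {φ0 φp φm ψ0 ψp ψm gφ gψ hφ hψ : ℝ} (hφ0 : |φ0| ≤ 1) (hψ0 : |ψ0| ≤ 1)
    (hφp : |φp - φ0| ≤ gφ) (hφm : |φm - φ0| ≤ gφ) (hψp : |ψp - ψ0| ≤ gψ) (hψm : |ψm - ψ0| ≤ gψ)
    (hφ2 : |φp + φm - 2 * φ0| ≤ hφ) (hψ2 : |ψp + ψm - 2 * ψ0| ≤ hψ) :
    |φp * ψp + φm * ψm - 2 * (φ0 * ψ0)| ≤ hφ + hψ + 2 * (gφ * gψ) := by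
  have hg : 0 ≤ gφ := (abs_nonneg _).trans hφp
  have t1 : |φ0 * (ψp + ψm - 2 * ψ0)| ≤ hψ := by
    rw [abs_mul]; exact (mul_le_mul hφ0 hψ2 (abs_nonneg _) zero_le_one).trans (le_of_eq (one_mul _))
  have t2 : |ψ0 * (φp + φm - 2 * φ0)| ≤ hφ := by
    rw [abs_mul]; exact (mul_le_mul hψ0 hφ2 (abs_nonneg _) zero_le_one).trans (le_of_eq (one_mul _))
  have t3 : |(φp - φ0) * (ψp - ψ0)| ≤ gφ * gψ := by rw [abs_mul]; exact mul_le_mul hφp hψp (abs_nonneg _) hg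
  have t4 : |(φm - φ0) * (ψm - ψ0)| ≤ gφ * gψ := by rw [abs_mul]; exact mul_le_mul hφm hψm (abs_nonneg _) hg
  rw [mul_second_diff_eq]
  calc |φ0 * (ψp + ψm - 2 * ψ0) + ψ0 * (φp + φm - 2 * φ0) + (φp - φ0) * (ψp - ψ0) + (φm - φ0) * (ψm - ψ0)|
      ≤ |φ0 * (ψp + ψm - 2 * ψ0)| + |ψ0 * (φp + φm - 2 * φ0)| + |(φp - φ0) * (ψp - ψ0)| + |(φm - φ0) * (ψm - ψ0)| := by
        refine (abs_add_le _ _).trans (add_le_add ((abs_add_le _ _).trans (add_le_add (abs_add_le _ _) le_rfl)) le_rfl)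
    _ ≤ hψ + hφ + gφ * gψ + gφ * gψ := by linarith
    _ = hφ + hψ + 2 * (gφ * gψ) := by ring

/-! ## §4 Finite products of cutoffs -/

section Prod

variable {ι : Type*}

/-- a product of `[−1,1]`-valued factors is `[−1,1]`-valued. [folklore] -/
theorem abs_prod_le_one (s : Finset ι) {Φ : ι → ℝ} (h : ∀ j ∈ s, |Φ j| ≤ 1) : |∏ j ∈ s, Φ j| ≤ 1 := by
  rw [Finset.abs_prod]
  exact Finset.prod_le_one (fun j _ => abs_nonneg _) h

/-- **FIRST DIFFERENCES OF A FINITE PRODUCT**: `|Π_j φ_j(y+e) − Π_j φ_j(y)| ≤ Σ_j g_j` (all factors `[−1,1]`-valued). [folklore] -/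
theorem abs_prod_diff_le [DecidableEq ι] (s : Finset ι) {Φ0 Φp g : ι → ℝ} (h0 : ∀ j ∈ s, |Φ0 j| ≤ 1) (hp : ∀ j ∈ s, |Φp j| ≤ 1)
    (hd : ∀ j ∈ s, |Φp j - Φ0 j| ≤ g j) : |∏ j ∈ s, Φp j - ∏ j ∈ s, Φ0 j| ≤ ∑ j ∈ s, g j := by
  induction s using Finset.induction_on with
  | empty => simp
  | @insert a s ha ih =>
    rw [Finset.prod_insert ha, Finset.prod_insert ha, Finset.sum_insert ha]
    have haS := Finset.mem_insert_self a s
    have h0' : ∀ j ∈ s, |Φ0 j| ≤ 1 := fun j hj => h0 j (Finset.mem_insert_of_mem hj)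
    have hp' : ∀ j ∈ s, |Φp j| ≤ 1 := fun j hj => hp j (Finset.mem_insert_of_mem hj)
    have hd' : ∀ j ∈ s, |Φp j - Φ0 j| ≤ g j := fun j hj => hd j (Finset.mem_insert_of_mem hj)
    have e : Φp a * ∏ j ∈ s, Φp j - Φ0 a * ∏ j ∈ s, Φ0 j
        = (Φp a - Φ0 a) * ∏ j ∈ s, Φp j + Φ0 a * (∏ j ∈ s, Φp j - ∏ j ∈ s, Φ0 j) := by ring
    rw [e]
    refine (abs_add_le _ _).trans (add_le_add ?_ ?_)
    · rw [abs_mul]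
      exact (mul_le_mul (hd a haS) (abs_prod_le_one s hp') (abs_nonneg _) ((abs_nonneg _).trans (hd a haS))).trans
        (le_of_eq (mul_one _))
    · rw [abs_mul]
      exact (mul_le_mul (h0 a haS) (ih h0' hp' hd') (abs_nonneg _) zero_le_one).trans (le_of_eq (one_mul _))

/-- **SECOND DIFFERENCES OF A FINITE PRODUCT**: `|Π_j φ_j(y+e) + Π_j φ_j(y−e) − 2Π_j φ_j(y)| ≤ Σ_j h_j + (Σ_j g_j)²` (all factors
`[−1,1]`-valued, `g_j ≥ 0`). [folklore] -/
theorem abs_prod_second_diff_le [DecidableEq ι] (s : Finset ι) {Φ0 Φp Φm g h : ι → ℝ} (h0 : ∀ j ∈ s, |Φ0 j| ≤ 1)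
    (hp : ∀ j ∈ s, |Φp j| ≤ 1) (hm : ∀ j ∈ s, |Φm j| ≤ 1) (hg : ∀ j ∈ s, 0 ≤ g j)
    (hdp : ∀ j ∈ s, |Φp j - Φ0 j| ≤ g j) (hdm : ∀ j ∈ s, |Φm j - Φ0 j| ≤ g j) (hd2 : ∀ j ∈ s, |Φp j + Φm j - 2 * Φ0 j| ≤ h j) :
    |∏ j ∈ s, Φp j + ∏ j ∈ s, Φm j - 2 * ∏ j ∈ s, Φ0 j| ≤ ∑ j ∈ s, h j + (∑ j ∈ s, g j) ^ 2 := by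
  induction s using Finset.induction_on with
  | empty => norm_num
  | @insert a s ha ih =>
    rw [Finset.prod_insert ha, Finset.prod_insert ha, Finset.prod_insert ha, Finset.sum_insert ha, Finset.sum_insert ha]
    have haS := Finset.mem_insert_self a s
    have h0' : ∀ j ∈ s, |Φ0 j| ≤ 1 := fun j hj => h0 j (Finset.mem_insert_of_mem hj)
    have hp' : ∀ j ∈ s, |Φp j| ≤ 1 := fun j hj => hp j (Finset.mem_insert_of_mem hj)
    have hm' : ∀ j ∈ s, |Φm j| ≤ 1 := fun j hj => hm j (Finset.mem_insert_of_mem hj)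
    have hg' : ∀ j ∈ s, 0 ≤ g j := fun j hj => hg j (Finset.mem_insert_of_mem hj)
    have hdp' : ∀ j ∈ s, |Φp j - Φ0 j| ≤ g j := fun j hj => hdp j (Finset.mem_insert_of_mem hj)
    have hdm' : ∀ j ∈ s, |Φm j - Φ0 j| ≤ g j := fun j hj => hdm j (Finset.mem_insert_of_mem hj)
    have hd2' : ∀ j ∈ s, |Φp j + Φm j - 2 * Φ0 j| ≤ h j := fun j hj => hd2 j (Finset.mem_insert_of_mem hj)
    have hR := ih h0' hp' hm' hg' hdp' hdm' hd2'
    have hRp := abs_prod_diff_le s h0' hp' hdp'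
    have hRm := abs_prod_diff_le s h0' hm' hdm'
    have hG : 0 ≤ ∑ j ∈ s, g j := Finset.sum_nonneg hg'
    have h2 := abs_mul_second_diff_le (h0 a haS) (abs_prod_le_one s h0') (hdp a haS) (hdm a haS) hRp hRm (hd2 a haS) hR
    refine h2.trans ?_
    nlinarith [hg a haS, hG, sq_nonneg (g a)]

end Prod

end Summit.QuantumFields.BalabanUV.T4Continuum.DirichletCutoffCalculus

end
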